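import Summits.NavierStokesRegularity.NavierStokesRegularity.Theorems.TypeIQuantSubcubicExp.Negative.ThinObjectGaugeLoadBearing
import Summits.NavierStokesRegularity.NavierStokesRegularity.Theorems.QuarterLogPincerTypeIQuantSubcubicExpThinObjectRungs
import HarnessLib

/-!
# Stub S3 `stub_thinCascadeLiouville` (stmt-NavierStokesRegularity-24077, line `thin_cascade`):
# the gauge REJECTS the gauge-free witness — the swirl `Jx/(‖x‖² − t)` is not Oseen-mild

Refuter-side negative-lane corollary (seat ns-afl-r1 g7, `--supports stmt-NavierStokesRegularity-24077`).
No summit statement is proved; S3 and 24077 stay OPEN.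

`Negative/ThinObjectGaugeLoadBearing.lean` shows that the scaled swirl `swirlScaled ε` (`0 < ε ≤ 1`)
satisfies every clause of `ThinObject M q` except the Oseen integral equation, and that it is backward
self-similar.  The landed rung `Theorems.ThinCascade.thinObject_not_selfSimilar` (a genuine thin object is never
self-similar — Tsai / Chae–Wolf near-one DSS exclusion, through `AxisActivity.thinObject_not_nearOneDss`)
therefore turns around into a statement about the explicit field:

* `swirlScaled_not_isTypeIAncientMild` — for `0 < ε ≤ 1` and EVERY constant `M`, the scaled swirl is
  not a Type-I ancient mild solution;
* `swirlScaled_not_oseenMild` — since its other three conjuncts hold (`RssFarFieldLoadBearing`: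
  jointly smooth, divergence free, Type-I with constant `ε`), what fails is exactly the KNSS/Oseen
  integral equation `v(t) = e^{(t−s)Δ}v(s) − B(v,v)(s,t)` between negative times: the tree's
  Navier–Stokes content (the Liouville rung) rejects the explicit divergence-free self-similar field
  `ε Jx/(‖x‖² − t)` WITHOUT any direct computation of `∂ₜv − Δv + (v·∇)v + ∇p`.

So the dropped conjunct of `thinCascadeLiouville_false_without_gauge` is not only sufficient to exclude
the witness but is witnessed to do so by the line's own rungs.  Standard axioms only.
-/

noncomputable section

-- the summit and its single sub-problem share the name (CONVENTIONS §1), as in every Theorems file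
set_option linter.dupNamespace false

namespace Summit.NavierStokesRegularity.NavierStokesRegularity.Theorems.TypeIQuantSubcubicExp.Negative

open MeasureTheory Set Filter Topology Metric Function
open Literature.Analysis Literature.Analysis.FluidPDE
open Summit.NavierStokesRegularity.NavierStokesRegularity.Cruxes.TypeIQuantSubcubicExp.ThinCascade
open Summit.NavierStokesRegularity.NavierStokesRegularity.Theorems.SymmetricLiouville.Negative
open scoped ENNReal NNReal RealInnerProductSpace

/-- **The scaled swirl is not a Type-I ancient mild solution**, for `0 < ε ≤ 1` and every constant
`M`: otherwise, with `q = 3|B₁|ε³`, the pair `(swirlScaled ε, swirlScaled ε 0)` would be a genuine thin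
object (`swirlScaled_thinObject_clauses` supplies clauses (2)–(6)), contradicting the self-similar
exclusion `Theorems.ThinCascade.thinObject_not_selfSimilar` (`isSelfSimilar_swirlScaled`). -/
theorem swirlScaled_not_isTypeIAncientMild {ε : ℝ} (hε : 0 < ε) (hε1 : ε ≤ 1) (M : ℝ) :
    ¬ IsTypeIAncientMild M (swirlScaled ε) := by
  intro hmild
  obtain ⟨-, hrest⟩ := swirlScaled_thinObject_clauses (M := max M ε)
    (q := 3 * (volume : Measure (EuclideanSpace ℝ (Fin 3))).real (ball 0 1) * ε ^ 3) hε hε1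
    (le_max_right M ε) le_rfl
  have hT : ThinObject M (3 * (volume : Measure (EuclideanSpace ℝ (Fin 3))).real (ball 0 1) * ε ^ 3)
      (swirlScaled ε) (swirlScaled ε 0) := by
    unfold ThinObject
    exact ⟨hmild, hrest⟩
  exact Theorems.ThinCascade.thinObject_not_selfSimilar hT (isSelfSimilar_swirlScaled ε)

/-- **What fails is exactly the Oseen integral equation.**  For `0 < ε ≤ 1` the scaled swirl
`ε Jx/(‖x‖² − t)` — jointly smooth on the open past, divergence free, Type-I with constant `ε` — does
NOT satisfy the KNSS/Oseen-mild relation between negative times. -/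
theorem swirlScaled_not_oseenMild {ε : ℝ} (hε : 0 < ε) (hε1 : ε ≤ 1) :
    ¬ (∀ s t : ℝ, s < t → t < 0 → ∀ x,
        swirlScaled ε t x =
          heatFlow (swirlScaled ε s) (t - s) x - oseenDuhamel 1 s (swirlScaled ε) (swirlScaled ε) t x) :=
  fun hO => swirlScaled_not_isTypeIAncientMild hε hε1 ε
    ⟨swirlScaled_smooth ε, fun _ ht => swirlScaled_divFree ε ht, hO, swirlScaled_typeI hε.le⟩

/-- In particular the unscaled swirl `Jx/(‖x‖² − t)` of `RssFarFieldLoadBearing` is not Oseen-mild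
(`swirlScaled 1 = swirlField` pointwise). -/
theorem swirlField_not_oseenMild :
    ¬ (∀ s t : ℝ, s < t → t < 0 → ∀ x,
        swirlField t x =
          heatFlow (swirlField s) (t - s) x - oseenDuhamel 1 s swirlField swirlField t x) := by
  have h1 : swirlScaled 1 = swirlField := by
    funext t x
    rw [swirlScaled_apply, one_smul]
  simpa only [h1] using swirlScaled_not_oseenMild one_pos le_rfl

end Summit.NavierStokesRegularity.NavierStokesRegularity.Theorems.TypeIQuantSubcubicExp.Negative

end
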